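import Summits.Langlands.Langlands.Theses.OddResidueBelowFive
import Literature.NumberTheory.Automorphic.CompletedCohomologyHeckeAlgebraGLn
import Summits.Langlands.Langlands.Theorems.DyadicOddResidueDyadicDihedralFMDictionary

/-!
# Birth skeleton (BC3) — crux `OddResidueBelowFive.ThreeAdicSmallImage` (item stmt-Langlands-18717)

Line `birth` for the rank-4 crux of route `Langlands/OddResidueBelowFive`: the odd regular
Fontaine–Mazur theorem over `ℚ` at `p = 3` in the residual cell "`ρ̄` absolutely reducible OR of
dihedral type, `ρ|_{Γ_{ℚ₃}}` irreducible" (Pan's excluded exceptional block `(ρ̄|G_{ℚ₃})^{ss} = η ⊕ ηω`).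

The skeleton is the TWO-STEP STRUCTURE OF THE PRINTED PROOFS (Pan, JAMS 35 (2022) = arXiv:1901.07166,
§1 p. 3: "There are two steps: • Prove a `big' R = 𝕋 result … • Prove a classicality result: if ρ
arises from some completed cohomology and ρ|G_{ℚ_p} is irreducible, de Rham of distinct Hodge–Tate
weights, then it comes from a classical eigenform"; X. Zhang, arXiv:2412.06812, Thm. 1.0.2 = Thms.
5.1.1 / 6.1.1 removes Pan's `p = 3` proviso with the same architecture, §4 "Pro-modularity"), typed
over the tree's vocabulary:

* `stub_proModular` (the heart; the route's own reading "each residual cell is an OCCURRENCE-in-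
  completed-cohomology statement"): every `ρ` of the cell is `3`-ADICALLY AUTOMORPHIC of some tame
  level — a continuous `ℚ̄₃`-point of the completed-cohomology Hecke algebra of `GL₂/ℚ`
  (`BigHeckeGLn.TameLevel.IsPadicallyAutomorphic`, Pan's "pro-modular", Forum Math. Pi 10 (2022)
  Def. 6.1.2).  Engines in print: Skinner–Wiles pseudo-deformation rings + patching of completed
  homology at nice primes in the exceptional block (Zhang §4–5, big `R = 𝕋` Thm. "R=T" and Lemma
  5.1.2; Pan §7) for `ρ̄` reducible, patching at a non-Eisenstein ideal (Zhang §6, Pan §8–9) for `ρ̄`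
  dihedral.  NOT in the tree in any form (no theorem produces `IsPadicallyAutomorphic`).
* `stub_classical` (in print for every `p`): a `3`-adically automorphic, irreducible, almost
  everywhere unramified `ρ` which is de Rham at `3` with distinct labelled Hodge–Tate weights is, up
  to a Tate twist `ρ ⊗ ε₃^m`, the Galois representation of a newform (Pan, arXiv:2209.06366 Thm.
  1.1.2 = Thm. 7.1.2 with Forum Pi Cor. 6.3.6 and Paškūnas–Tung 2021 Thm. 7.1; at `p = 3` also a
  case of Zhang's Thm. 1.0.2 since pro-modular ⟹ odd, `IsPadicallyAutomorphic.isOdd`).  Same shape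
  as the vendored fact `Pan2022_proModularDeRhamClassical_GL2Q` minus its residual hypothesis; in
  the tree it is `proModularDeRhamClassical_GL2Q_of_ne_two` at `p = 3`, CONDITIONAL on the named
  fact `XZhang2024_fontaineMazurGL2_tateTwist`.
* the dictionary "Tate-twisted newform ⟹ `L`-algebraic cuspidal `π` of `GL₂(𝔸_ℚ)` with a.e.
  Satake–Frobenius matching" is the LANDED theorem
  `Summit.Langlands.Langlands.Theorems.DyadicDihedralFM.stub_dictionary` (every prime `ℓ`; used at
  `ℓ = 3`), so it is consumed in the composition, not re-stubbed.

`ThreeAdicSmallImage_of` concludes the route decl BY NAME; its body is a real proof (the two stubs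
composed with the landed dictionary); the only `sorry`s of the file are the two stubs.  The explicit
implication `stub_proModular-sig → stub_classical-sig → ThreeAdicSmallImage` is the sorry-free
`example` at the end.  Disproof used: none (no `Cruxes/ThreeAdicSmallImage/Disproof.lean` exists at
registration; `ledger negatives --problem Langlands` has no statement about this cell).
-/

set_option linter.dupNamespace false

namespace Summit.Langlands.Langlands.Cruxes.ThreeAdicSmallImage.Birth

open Summit.Langlands.Langlands.Theses.OddResidueBelowFive

/-- Stub 1 (L/XL) — PRO-MODULARITY IN THE EXCEPTIONAL 3-ADIC BLOCK.  Every continuous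
`ρ : Γ_ℚ → GL₂(ℚ̄₃)` which is odd, irreducible, unramified almost everywhere, de Rham at `3` with
distinct labelled Hodge–Tate weights (Fontaine's pinned datum), whose reduction is absolutely
reducible or of dihedral type, and whose restriction to `Γ_{ℚ₃}` is irreducible, is `3`-adically
automorphic of some tame level `𝒰` (a continuous `ℚ̄₃`-valued point of the completed-cohomology Hecke
algebra `𝕋(𝒰)` of `GL₂/ℚ` associated with `ρ` at the good places: Pan's "pro-modular").
Why plausible: it is what the printed proofs establish first (big `R^{ps} = 𝕋_𝔪` on the relevant
components, nice primes found via Böckle's rings and a generalised Greenberg–Wiles formula when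
`χ̄ = ω^{±1}`), and a posteriori it follows from the modularity of `ρ` (classical ⟹ pro-modular).
Why it might fail as typed: only through the rendering of `TameLevel`/`IsAssociated` (arithmetic
Frobenius normalisation `X² - x(T_{v,1})X + q_v x(T_{v,2})`); mathematically it is Zhang Thm. 1.0.2 ∘
(eigenform ⟹ point of `𝕋(K^p)`).
[cite: arXiv:2412.06812, §4 and Thm. 5.1.1 / Lemma 5.1.2 (p. 26), Thm. 6.1.1 (p. 33)]
[cite: arXiv:1901.07166, §1 (p. 3, "big R = 𝕋"), Thm. 7.1.1, Thm. 8.0.24]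
[cite: arXiv:2008.07099, Def. 6.1.2] [cite: doi:10.1007/bf02698855 (Skinner–Wiles)] -/
theorem stub_proModular : ∀ (ρ : Literature.NumberTheory.GaloisRepresentations.FramedGaloisRep ℚ (PadicAlgCl 3) 2), ρ.IsOdd → ρ.toGaloisRep.IsIrreducible → (∀ᶠ v : IsDedekindDomain.HeightOneSpectrum (NumberField.RingOfIntegers ℚ) in Filter.cofinite, ρ.IsUnramifiedAt v) → (∀ (v : IsDedekindDomain.HeightOneSpectrum (NumberField.RingOfIntegers ℚ)) (hv : ((3 : ℕ) : NumberField.RingOfIntegers ℚ) ∈ v.asIdeal), (Literature.NumberTheory.PAdicHodge.fontainePstAdicCompletion v 3 hv).IsDeRhamFramed (ρ.toLocal v) ∧ ∀ τ : v.adicCompletion ℚ →+* PadicAlgCl 3, Continuous τ → (ρ.labelledHodgeTateWeightsAt v (Literature.NumberTheory.PAdicHodge.fontainePstAdicCompletion v 3 hv).algebra (Literature.NumberTheory.PAdicHodge.fontainePstAdicCompletion v 3 hv).𝔅 τ).Nodup) → (¬ ρ.IsResiduallyAbsIrreducible ∨ Literature.NumberTheory.GaloisRepresentations.IsDihedralType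 ρ.residualRep) → (∀ (v : IsDedekindDomain.HeightOneSpectrum (NumberField.RingOfIntegers ℚ)) (hv : ((3 : ℕ) : NumberField.RingOfIntegers ℚ) ∈ v.asIdeal), Literature.NumberTheory.GaloisRepresentations.FramedRep.IsIrreducible (ρ.toLocal v)) → ∃ 𝒰 : Literature.NumberTheory.Automorphic.BigHeckeGLn.TameLevel 2 ℚ 3, 𝒰.IsPadicallyAutomorphic ρ := by
  sorry

/-- Stub 2 (L; in print for every `p`) — CLASSICALITY OF PRO-MODULAR REGULAR DE RHAM POINTS AT 3.
A continuous `ρ : Γ_ℚ → GL₂(ℚ̄₃)` which is irreducible, unramified almost everywhere, de Rham at `3`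
with distinct labelled Hodge–Tate weights and `3`-adically automorphic of some tame level is, up to
a Tate twist, the Galois representation of a newform: there are `χ = ε₃^m` (`m ∈ ℤ`,
`ε₃ = cyclotomicPadicAlgCl ℚ 3`), a newform `f ∈ S_k(Γ₁(N))` and `ι_f : K_f → ℚ̄₃` with `ρ ⊗ χ`
attached to `f` away from `3N` (arithmetic Frobenius, `IsGaloisRepOfNewform1`).
Why plausible: Pan, arXiv:2209.06366 Thm. 1.1.2 ("ρ appears in H̃¹(K^p, E), de Rham of weights
0, k ⟹ ρ arises from a cuspidal eigenform of weight k + 1", any `p`) with Forum Pi Cor. 6.3.6 and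
Paškūnas–Tung Thm. 7.1; oddness is automatic (`IsPadicallyAutomorphic.isOdd`, proved), so at the
odd prime `3` it is also a case of Zhang's Thm. 1.0.2 — in the tree:
`Literature.NumberTheory.Automorphic.proModularDeRhamClassical_GL2Q_of_ne_two hX 3` with
`hX : XZhang2024_fontaineMazurGL2_tateTwist` (conditional close available now).  VERBATIM the body
of `Pan2022_proModularDeRhamClassical_GL2Q` at `p = 3` minus its residual hypothesis.
Why it might fail as typed: for residually REDUCIBLE `ρ̄` the passage "eigensystem point ⟹
`Hom_{G_ℚ}(ρ, H̃¹) ≠ 0`" is Pan 2022 §3 local–global compatibility in the exceptional block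
(Zhang §3), not Cor. 6.3.6 — covered at `p = 3` by Zhang's theorem in any case.
[cite: arXiv:2209.06366, Thm. 1.1.2 (= Thm. 7.1.2) and §7.2.1] [cite: arXiv:2008.07099, Def. 6.1.2, Cor. 6.3.6]
[cite: arXiv:2104.08948, Thm. 7.1] [cite: arXiv:2412.06812, Thm. 1.0.2] -/
theorem stub_classical : ∀ (ρ : Literature.NumberTheory.GaloisRepresentations.FramedGaloisRep ℚ (PadicAlgCl 3) 2), ρ.toGaloisRep.IsIrreducible → (∀ᶠ v : IsDedekindDomain.HeightOneSpectrum (NumberField.RingOfIntegers ℚ) in Filter.cofinite, ρ.IsUnramifiedAt v) → (∀ (v : IsDedekindDomain.HeightOneSpectrum (NumberField.RingOfIntegers ℚ)) (hv : ((3 : ℕ) : NumberField.RingOfIntegers ℚ) ∈ v.asIdeal), (Literature.NumberTheory.PAdicHodge.fontainePstAdicCompletion v 3 hv).IsDeRhamFramed (ρ.toLocal v) ∧ ∀ τ : v.adicCompletion ℚ →+* PadicAlgCl 3, Continuous τ → (ρ.labelledHodgeTateWeightsAt v (Literature.NumberTheory.PAdicHodge.fontainePstAdicCompletion v 3 hv).algebra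 (Literature.NumberTheory.PAdicHodge.fontainePstAdicCompletion v 3 hv).𝔅 τ).Nodup) → (∃ 𝒰 : Literature.NumberTheory.Automorphic.BigHeckeGLn.TameLevel 2 ℚ 3, 𝒰.IsPadicallyAutomorphic ρ) → ∃ (χ : Field.absoluteGaloisGroup ℚ →ₜ* (PadicAlgCl 3)ˣ) (m : ℤ), (∀ σ, χ σ = Literature.NumberTheory.GaloisRepresentations.cyclotomicPadicAlgCl ℚ 3 σ ^ m) ∧ ∃ (N : ℕ) (_ : NeZero N) (k : ℤ) (f : CuspForm (CongruenceSubgroup.Gamma1 N) k) (ιf : Literature.NumberTheory.EllipticCurves.ModularForms.coeffCharField f →+* PadicAlgCl 3), Literature.NumberTheory.EllipticCurves.ModularForms.IsNewform1 f ∧ Literature.NumberTheory.EllipticCurves.ModularForms.IsGaloisRepOfNewform1 f ιf {q | q ∣ N * 3} (Literature.NumberTheory.GaloisRepresentations.FramedRep.twist ρ χ) := by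
  sorry

/-- **The skeleton theorem: `stub_proModular`, `stub_classical` and the landed dictionary
`Theorems.DyadicDihedralFM.stub_dictionary` (at `ℓ = 3`) prove the crux**, concluded BY NAME.
Real proof; the only `sorry`s it depends on are the two declared stubs. -/
theorem ThreeAdicSmallImage_of : ThreeAdicSmallImage := by
  intro ρ hodd hirr hur hdR hcell hloc ι hcpt
  exact Summit.Langlands.Langlands.Theorems.DyadicDihedralFM.stub_dictionary 3 ρ
    (stub_classical ρ hirr hur hdR (stub_proModular ρ hodd hirr hur hdR hcell hloc)) hcpt ι

/-- The composition as an explicit, sorry-free implication `stub_proModular-sig →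
stub_classical-sig → ThreeAdicSmallImage` (BC3 shape `<C>_of : <stub sigs> → C`; kept as an
`example` so that exactly one declaration of the file concludes the crux by name). -/
example :
    (∀ (ρ : Literature.NumberTheory.GaloisRepresentations.FramedGaloisRep ℚ (PadicAlgCl 3) 2), ρ.IsOdd → ρ.toGaloisRep.IsIrreducible → (∀ᶠ v : IsDedekindDomain.HeightOneSpectrum (NumberField.RingOfIntegers ℚ) in Filter.cofinite, ρ.IsUnramifiedAt v) → (∀ (v : IsDedekindDomain.HeightOneSpectrum (NumberField.RingOfIntegers ℚ)) (hv : ((3 : ℕ) : NumberField.RingOfIntegers ℚ) ∈ v.asIdeal), (Literature.NumberTheory.PAdicHodge.fontainePstAdicCompletion v 3 hv).IsDeRhamFramed (ρ.toLocal v) ∧ ∀ τ : v.adicCompletion ℚ →+* PadicAlgCl 3, Continuous τ → (ρ.labelledHodgeTateWeightsAt v (Literature.NumberTheory.PAdicHodge.fontainePstAdicCompletion v 3 hv).algebra (Literature.NumberTheory.PAdicHodge.fontainePstAdicCompletion v 3 hv).𝔅 τ).Nodup) → (¬ ρ.IsResiduallyAbsIrreducible ∨ Literature.NumberTheory.GaloisRepresentations.IsDihedralType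 ρ.residualRep) → (∀ (v : IsDedekindDomain.HeightOneSpectrum (NumberField.RingOfIntegers ℚ)) (hv : ((3 : ℕ) : NumberField.RingOfIntegers ℚ) ∈ v.asIdeal), Literature.NumberTheory.GaloisRepresentations.FramedRep.IsIrreducible (ρ.toLocal v)) → ∃ 𝒰 : Literature.NumberTheory.Automorphic.BigHeckeGLn.TameLevel 2 ℚ 3, 𝒰.IsPadicallyAutomorphic ρ) →
    (∀ (ρ : Literature.NumberTheory.GaloisRepresentations.FramedGaloisRep ℚ (PadicAlgCl 3) 2), ρ.toGaloisRep.IsIrreducible → (∀ᶠ v : IsDedekindDomain.HeightOneSpectrum (NumberField.RingOfIntegers ℚ) in Filter.cofinite, ρ.IsUnramifiedAt v) → (∀ (v : IsDedekindDomain.HeightOneSpectrum (NumberField.RingOfIntegers ℚ)) (hv : ((3 : ℕ) : NumberField.RingOfIntegers ℚ) ∈ v.asIdeal), (Literature.NumberTheory.PAdicHodge.fontainePstAdicCompletion v 3 hv).IsDeRhamFramed (ρ.toLocal v) ∧ ∀ τ : v.adicCompletion ℚ →+* PadicAlgCl 3, Continuous τ → (ρ.labelledHodgeTateWeightsAt v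 (Literature.NumberTheory.PAdicHodge.fontainePstAdicCompletion v 3 hv).algebra (Literature.NumberTheory.PAdicHodge.fontainePstAdicCompletion v 3 hv).𝔅 τ).Nodup) → (∃ 𝒰 : Literature.NumberTheory.Automorphic.BigHeckeGLn.TameLevel 2 ℚ 3, 𝒰.IsPadicallyAutomorphic ρ) → ∃ (χ : Field.absoluteGaloisGroup ℚ →ₜ* (PadicAlgCl 3)ˣ) (m : ℤ), (∀ σ, χ σ = Literature.NumberTheory.GaloisRepresentations.cyclotomicPadicAlgCl ℚ 3 σ ^ m) ∧ ∃ (N : ℕ) (_ : NeZero N) (k : ℤ) (f : CuspForm (CongruenceSubgroup.Gamma1 N) k) (ιf : Literature.NumberTheory.EllipticCurves.ModularForms.coeffCharField f →+* PadicAlgCl 3), Literature.NumberTheory.EllipticCurves.ModularForms.IsNewform1 f ∧ Literature.NumberTheory.EllipticCurves.ModularForms.IsGaloisRepOfNewform1 f ιf {q | q ∣ N * 3} (Literature.NumberTheory.GaloisRepresentations.FramedRep.twist ρ χ)) →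
    ThreeAdicSmallImage :=
  fun hA hB ρ hodd hirr hur hdR hcell hloc ι hcpt =>
    Summit.Langlands.Langlands.Theorems.DyadicDihedralFM.stub_dictionary 3 ρ
      (hB ρ hirr hur hdR (hA ρ hodd hirr hur hdR hcell hloc)) hcpt ι

end Summit.Langlands.Langlands.Cruxes.ThreeAdicSmallImage.Birth
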